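import Mathlib
import Literature.Computability.Complexity.CliqueTestGraphs
import Summits.PneNP.PneNP.Theorems.ConvexRankGatesConvexGateBlindColouringTheta
import Summits.PneNP.PneNP.Theorems.ConvexRankGatesConvexGateBlindRainbowFunctional

/-!
# PneNP / ConvexRankGates — `ConvexGateBlind`: the CLASS-WINDOW certificate (the matching upper bound for local / symmetric LP certificates)

Helpers (`--supports stmt-PneNP-10680`). The lower bounds of `…SharpJunta.lean` (no local certificate with sets of size
`≤ k - 1`) and `…SymmetricBlind.lean` (no `Sym(m)`-symmetric certificate family with fewer than `C(m, t+1)` terms) are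
complemented here by the natural POSITIVE example, so that refuters and planners can read off the remaining gap:

* `cdist_colorVec_eq_sum_choose` — `cdist Q (colorVec h) = ∑_i C(#(Q ∩ V_i), 2)` (classes `V_i = cls h i`);
* `classWindow_rep` — for every colouring `h : Fin m → Fin K`, every `(K+1)`-set `Q` and every `ε`:
  `cdist Q (colorVec h) - ε = ∑_i g_ε(#(Q ∩ V_i))` with `g_ε(q) = (q-1)(q-2ε)/2` (since `∑_i (#(Q ∩ V_i) - 1) = 1`), and
  `classWindow_nonneg` — `g_ε ≥ 0` on `ℕ` for `0 ≤ ε ≤ 1`;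
* `classWindow_factorisation` (registered stub `class_window`) — hence, for a colouring with classes of size `n ≥ 1`, the
  column `cdist · (colorVec h) - ε` IS a non-negative combination of the `C(m, n)` window functions
  `Q ↦ g_ε(#(Q ∩ S))`, `#S = n` — a `Sym(m)`-symmetric family of `n`-juntas (`n = m/K ≈ m^{1-δ}`), the same family for
  every colouring column and every `ε ∈ [0,1]`.

So for the colouring columns of `D - εJ`: local certificates need sets of size `≥ k` (sharp) and size `m/K` suffices;
symmetric families need `≥ C(m, ⌊K/2⌋+1)` (resp. `C(m, K)`) terms and `C(m, m/K)` suffice. [folklore; s11 §3(ii)]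
-/

set_option linter.dupNamespace false

namespace Summit.PneNP.PneNP.Theorems

open Finset Literature.Computability.Complexity
open Summit.PneNP.PneNP.Cruxes.ConvexGateBlind.StrictRankConicCover (cdist monoPairs two_mul_cdist_colorVec
  card_filter_prod_eq)

noncomputable section

variable {m K : ℕ}

/-! ## Occupancies -/

/-- The classes partition `Q`: `∑_i #(Q ∩ V_i) = #Q`. [folklore] -/
theorem sum_card_inter_cls (h : Fin m → Fin K) (Q : Finset (Fin m)) : ∑ i, (Q ∩ cls h i).card = Q.card := by
  classical
  have hfib := (Finset.card_eq_sum_card_fiberwise (s := Q) (t := (univ : Finset (Fin K))) (f := h)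
    (fun _ _ => mem_univ _)).symm
  rw [← hfib]
  refine Finset.sum_congr rfl fun i _ => ?_
  congr 1
  ext v
  simp [mem_cls]

/-- `∑_i #(Q ∩ V_i)² = #{(a,b) ∈ Q × Q | h a = h b}`. [folklore] -/
theorem sum_sq_card_inter_cls (h : Fin m → Fin K) (Q : Finset (Fin m)) :
    ∑ i, (Q ∩ cls h i).card ^ 2 = ((Q ×ˢ Q).filter fun p => h p.1 = h p.2).card := by
  classical
  have hsplit : ((Q ×ˢ Q).filter fun p => h p.1 = h p.2) =
      (univ : Finset (Fin K)).biUnion fun i => (Q ∩ cls h i) ×ˢ (Q ∩ cls h i) := by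
    ext ⟨a, b⟩
    simp only [mem_filter, mem_product, mem_biUnion, mem_univ, true_and, mem_inter, mem_cls]
    constructor
    · rintro ⟨⟨ha, hb⟩, hab⟩
      exact ⟨h a, ⟨ha, rfl⟩, hb, hab.symm⟩
    · rintro ⟨i, ⟨ha, hai⟩, hb, hbi⟩
      exact ⟨⟨ha, hb⟩, by rw [hai, hbi]⟩
  rw [hsplit, Finset.card_biUnion]
  · refine Finset.sum_congr rfl fun i _ => ?_
    rw [Finset.card_product, sq]
  · intro i _ j _ hij
    rw [Function.onFun, Finset.disjoint_left]
    rintro ⟨a, b⟩ hab hab'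
    rw [mem_product, mem_inter, mem_cls] at hab hab'
    exact hij (hab.1.2.symm.trans hab'.1.2)

/-- **The clique distance to a colouring column is the number of monochromatic pairs**:
`cdist Q (colorVec h) = ∑_i C(#(Q ∩ V_i), 2)`. [folklore] -/
theorem cdist_colorVec_eq_sum_choose (h : Fin m → Fin K) (Q : Finset (Fin m)) :
    cdist Q (colorVec h) = ∑ i, (((Q ∩ cls h i).card).choose 2 : ℝ) := by
  classical
  have h2 := two_mul_cdist_colorVec h Q
  have hcount := card_filter_prod_eq h Q
  have hsq := sum_sq_card_inter_cls h Q
  have hpart := sum_card_inter_cls h Q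
  -- `2 ∑ C(q_i,2) = ∑ q_i² - ∑ q_i = #monoPairs`
  have key : ∀ q : ℕ, (2 : ℝ) * (q.choose 2 : ℝ) = (q : ℝ) ^ 2 - q := by
    intro q
    rw [Nat.cast_choose_two]
    ring
  have hsum : (2 : ℝ) * ∑ i, (((Q ∩ cls h i).card).choose 2 : ℝ) =
      ∑ i, ((((Q ∩ cls h i).card : ℕ) : ℝ) ^ 2) - ∑ i, (((Q ∩ cls h i).card : ℕ) : ℝ) := by
    rw [Finset.mul_sum, ← Finset.sum_sub_distrib]
    exact Finset.sum_congr rfl fun i _ => key _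
  have hsqR : ∑ i, ((((Q ∩ cls h i).card : ℕ) : ℝ) ^ 2) = (((Q ×ˢ Q).filter fun p => h p.1 = h p.2).card : ℝ) := by
    exact_mod_cast hsq
  have hpartR : ∑ i, (((Q ∩ cls h i).card : ℕ) : ℝ) = (Q.card : ℝ) := by exact_mod_cast hpart
  rw [hsqR, hpartR, hcount] at hsum
  push_cast at hsum
  linarith

/-! ## The class-window certificate -/

/-- `∑_i (#(Q ∩ V_i) - 1) = #Q - K` over `ℝ`. [folklore] -/
theorem sum_card_inter_cls_sub_one (h : Fin m → Fin K) (Q : Finset (Fin m)) :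
    ∑ i, ((((Q ∩ cls h i).card : ℕ) : ℝ) - 1) = (Q.card : ℝ) - K := by
  rw [Finset.sum_sub_distrib, Finset.sum_const, Finset.card_univ, Fintype.card_fin, nsmul_eq_mul, mul_one]
  have := sum_card_inter_cls h Q
  rw [← this]
  push_cast
  ring

/-- **The class-window representation.** For every colouring `h : Fin m → Fin K`, every `(K+1)`-set `Q` and every `ε`:
`cdist Q (colorVec h) - ε = ∑_i g_ε(#(Q ∩ V_i))` with `g_ε(q) = (q - 1)(q - 2ε)/2`. [folklore] -/
theorem classWindow_rep (h : Fin m → Fin K) (Q : Finset (Fin m)) (hQ : Q.card = K + 1) (ε : ℝ) :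
    cdist Q (colorVec h) - ε =
      ∑ i, ((((Q ∩ cls h i).card : ℕ) : ℝ) - 1) * ((((Q ∩ cls h i).card : ℕ) : ℝ) - 2 * ε) / 2 := by
  have hone : ∑ i, ((((Q ∩ cls h i).card : ℕ) : ℝ) - 1) = 1 := by
    rw [sum_card_inter_cls_sub_one, hQ]; push_cast; ring
  have hchoose : ∀ q : ℕ, ((q.choose 2 : ℕ) : ℝ) = ((q : ℝ) - 1) * (q : ℝ) / 2 := by
    intro q
    rw [Nat.cast_choose_two]
    ring
  calc cdist Q (colorVec h) - ε
      = ∑ i, (((Q ∩ cls h i).card).choose 2 : ℝ) - ε * ∑ i, ((((Q ∩ cls h i).card : ℕ) : ℝ) - 1) := by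
        rw [cdist_colorVec_eq_sum_choose, hone, mul_one]
    _ = ∑ i, ((((Q ∩ cls h i).card).choose 2 : ℝ) - ε * ((((Q ∩ cls h i).card : ℕ) : ℝ) - 1)) := by
        rw [Finset.mul_sum, ← Finset.sum_sub_distrib]
    _ = ∑ i, ((((Q ∩ cls h i).card : ℕ) : ℝ) - 1) * ((((Q ∩ cls h i).card : ℕ) : ℝ) - 2 * ε) / 2 := by
        refine Finset.sum_congr rfl fun i _ => ?_
        rw [hchoose]
        ring

/-- `g_ε(q) = (q - 1)(q - 2ε)/2 ≥ 0` for every natural `q` and `0 ≤ ε ≤ 1`. [folklore] -/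
theorem classWindow_nonneg {ε : ℝ} (hε0 : 0 ≤ ε) (hε1 : ε ≤ 1) (q : ℕ) :
    0 ≤ ((q : ℝ) - 1) * ((q : ℝ) - 2 * ε) / 2 := by
  rcases q with _ | _ | q
  · simp; nlinarith
  · simp
  · have hq : (2 : ℝ) ≤ ((q + 2 : ℕ) : ℝ) := by exact_mod_cast (show 2 ≤ q + 2 by omega)
    apply div_nonneg _ (by norm_num)
    apply mul_nonneg <;> linarith

/-- **The class-window factorisation** (registered stub `class_window` of `stmt-PneNP-10680`): for a colouring
`h : Fin m → Fin K` with classes of size `n ≥ 1`, every `(K+1)`-set `Q` and every `ε`,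
`cdist Q (colorVec h) - ε = ∑_{#S = n} [S is a class of h] · g_ε(#(Q ∩ S))` — a non-negative (for `0 ≤ ε ≤ 1`,
`classWindow_nonneg`) combination of the `C(m, n)` window functions `g_ε(#(Q ∩ S))`, the SAME `Sym(m)`-symmetric family
of `n`-juntas for every colouring column: the positive counterpart of `…SharpJunta.lean` (sets of size `≤ k-1` never
suffice) and `…SymmetricBlind.lean` (symmetric families below `C(m, ⌊K/2⌋+1)` never suffice). [folklore] -/
theorem classWindow_factorisation : ∀ {m K n : ℕ} (h : Fin m → Fin K), (∀ c, (cls h c).card = n) → 1 ≤ n → ∀ (ε : ℝ) (Q : Finset (Fin m)), Q.card = K + 1 → cdist Q (colorVec h) - ε = ∑ S ∈ (Finset.univ : Finset (Fin m)).powersetCard n, (if ∃ i, S = cls h i then (1 : ℝ) else 0) * (((((Q ∩ S).card : ℕ) : ℝ) - 1) * ((((Q ∩ S).card : ℕ) : ℝ) - 2 * ε) / 2) := by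
  intro m K n h hn hn1 ε Q hQ
  classical
  rw [classWindow_rep h Q hQ ε]
  -- the classes are `n`-sets and `i ↦ cls h i` is injective (classes are non-empty)
  have hinj : Function.Injective fun i : Fin K => cls h i := by
    intro i j hij
    have hne : (cls h i).Nonempty := card_pos.1 (by rw [hn i]; exact hn1)
    obtain ⟨v, hv⟩ := hne
    have hv' : v ∈ cls h j := by rw [← show cls h i = cls h j from hij]; exact hv
    rw [mem_cls] at hv hv'
    exact hv.symm.trans hv'
  have himage : ∀ S ∈ (univ : Finset (Fin m)).powersetCard n,
      (if ∃ i, S = cls h i then (1 : ℝ) else 0) * (((((Q ∩ S).card : ℕ) : ℝ) - 1) * ((((Q ∩ S).card : ℕ) : ℝ) - 2 * ε) / 2)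
        = if S ∈ (univ : Finset (Fin K)).image (fun i => cls h i) then
            (((((Q ∩ S).card : ℕ) : ℝ) - 1) * ((((Q ∩ S).card : ℕ) : ℝ) - 2 * ε) / 2) else 0 := by
    intro S _
    by_cases hS : ∃ i, S = cls h i
    · rw [if_pos hS, one_mul, if_pos]
      obtain ⟨i, rfl⟩ := hS
      exact mem_image.2 ⟨i, mem_univ _, rfl⟩
    · rw [if_neg hS, zero_mul, if_neg]
      intro hmem
      obtain ⟨i, -, rfl⟩ := mem_image.1 hmem
      exact hS ⟨i, rfl⟩
  rw [Finset.sum_congr rfl himage, ← Finset.sum_filter]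
  have hfilter : ((univ : Finset (Fin m)).powersetCard n).filter
      (fun S => S ∈ (univ : Finset (Fin K)).image fun i => cls h i) = (univ : Finset (Fin K)).image fun i => cls h i := by
    ext S
    simp only [mem_filter, mem_powersetCard, subset_univ, true_and, mem_image, mem_univ, and_iff_right_iff_imp]
    rintro ⟨i, rfl⟩
    exact hn i
  rw [hfilter, Finset.sum_image fun i _ j _ hij => hinj hij]


/-- **Registered helper stub (the class-window certificate).** Restatement of `classWindow_factorisation` under the
registered name. -/
theorem class_window : ∀ {m K n : ℕ} (h : Fin m → Fin K), (∀ c, (cls h c).card = n) → 1 ≤ n → ∀ (ε : ℝ) (Q : Finset (Fin m)), Q.card = K + 1 → cdist Q (colorVec h) - ε = ∑ S ∈ (Finset.univ : Finset (Fin m)).powersetCard n, (if ∃ i, S = cls h i then (1 : ℝ) else 0) * (((((Q ∩ S).card : ℕ) : ℝ) - 1) * ((((Q ∩ S).card : ℕ) : ℝ) - 2 * ε) / 2) :=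
  fun h hn hn1 ε Q hQ => classWindow_factorisation h hn hn1 ε Q hQ

end

end Summit.PneNP.PneNP.Theorems
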